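import Literature.IUT.HodgeArakelov.ThetaEvaluationSettingProofs2
import Literature.IUT.HodgeArakelov.EtaleThetaDataOfSetting
import Literature.IUT.HodgeArakelov.MonoThetaCyclotomesBridgeEtTh
import Literature.AnabelianGeometry.EtaleTheta.TemperedCoverings
import HarnessLib

/-!
# [IUTchII] Def. 2.1 / Prop. 2.1 at the [EtTh] MODEL: the `BadPlaceSetting` of the Tate curve ((1,1)-ambient
# variant — print-level sibling: `BadPlaceSetting.ofUnderline`), and the well-definedness of Prop. 2.1 there
# modulo ONE tempered-anabelian input

S. Mochizuki, *Inter-universal Teichmüller theory II*, kurims manuscript (Dec. 2020) §2, p. 64 (the fixed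
data at `v ∈ 𝕍^bad`), Prop. 2.1 pp. 64–65 (claim key `Mochizuki2012`, DISPUTED, D-0012); [EtTh] §1–§2
(Publ. RIMS **45** (2009)) for the tempered tower `Π^tp_Ÿ ⊆ Π^tp_Y ⊆ Π^tp_X ⊇ Π^tp_X̲̲`
[cite: MochizukiEtTh2009, Def 2.13 p.47]. abc-iut cell (D-0067 wave 4, seat abc-iut-w4-d034); cone of
[IUTchIII] Cor. 3.12, DAG node **IUTchII:Prop2.1**; GAP-LEDGER row G-w4d010-3, residual (ii) ("the merge
instance"). MERGE-MAP row `BadPlaceSetting` TODO-merge:abc-iut-L2-t1/t2. Nothing landed is edited.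

WHAT IS BUILT. abc-iut-L6-d6/L6-t1's bridge B8 (`MonoThetaCyclotomesBridgeEtTh`, p-ids in MERGE-MAP §8)
gives the [IUTchII] §1 setting `ThetaSetting.ofDoubleUnderline C μ hC hS …` of the Tate curve over an [EtTh]
§1 theta setting `D` (abc-iut-L2-t1), étale theta data `E`, a choice `C : E.DoubleUnderline l` of `X̲̲`
(abc-iut-L2-t8) and a level-`N` cyclotome `μ`: its `Π^tp_{X̲̲_v}` IS `Π^tp_X̲̲ = C.Huu ⊆ Π^tp_X`. This file
EXTENDS it to the §2 setting at a bad place (`BadPlaceSetting`, abc-iut-L6-t1 `ThetaEvaluationSetting`):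
* `BadPlaceSetting.ofDoubleUnderline` — ambient group `PiXplain := Π^tp_X` (`D.PiTemp`, the [EtTh] §1
  once-punctured curve `X` of type `(1,1)`), the open injection `Π_v = Π^tp_X̲̲ ↪ Π^tp_X` = the subgroup
  inclusion, `Π^tp_Y = Ker(Π^tp_X ↠ Z)` (`D.GtpY`), `Π^tp_Ÿ` (`D.GtpYdd`, open under `K = K̈`, L2-t8
  `isOpen_GtpYdd`) as the bottom-row reference subgroups — i.e. the bottom row is [EtTh]'s
  `Π^tp_Ÿ ⊆ Π^tp_Y ⊆ Π^tp_X`; a CONSTRUCTION (no new `Prop` fact). **MODEL-IDENTIFICATION NOTE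
  (finding F-L6t19g5-1, abc-iut-L6-t19 gen 5, 2026-08-26; disclosed here doc-only, statements unchanged):
  print's "`X_v`" at `v ∈ 𝕍^bad` is `X̲_v := X̲_K ×_K K_v` of type `(1, l-tors)` ([IUTchI] Def. 3.1 (d)(e);
  [EtTh] Def. 2.1; [IUTchII] Rmk. 2.1.1 (i) "`Gal(Y_v/X_v)` … the subgroup `l·ℤ ⊆ ℤ`", Def. 2.3 (i)
  "`Π^±_v/Π_v ⥲ Gal(X̲̲_v/X_v) (≅ ℤ/lℤ)`"), whose tempered group is abc-iut-L2-t7's `D.GtpXu l = toZ⁻¹(l·ℤ)`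
  with `[Π^tp_{X̲_v} : Π_v] = l` — NOT the `(1,1)` curve `X`, for which `[Π^tp_X : Π_v] = l²`
  (`BadPlaceSetting.ofDoubleUnderline_index_eq_sq`, BadPlaceSettingOfDoubleUnderlineLevels.lean). So THIS
  record is the `(1,1)`-AMBIENT VARIANT of the printed setting; the PRINT-LEVEL model is the sibling
  `BadPlaceSetting.ofUnderline` (BadPlaceSettingOfUnderline.lean, abc-iut-L6-t19: `PiXplain := D.GtpXu l`,
  same `toThetaSetting`, and the SAME pair of reference subgroups of `Π_v` — `ofUnderline_refY_comap`,
  `ofUnderline_refYdd_comap` are `rfl` against the ones below). Every THEOREM of this file is a statement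
  about that pair of subgroups `Π_v ∩ Π^tp_Ÿ`, `Π_v ∩ Π^tp_Y` of `Π_v = Π^tp_X̲̲` and transfers verbatim
  (`isTopCharacteristic_refY_refYdd_ofUnderline`, `TemperedCoverings.YL_eq_of_piYddCharacteristic'`); no
  `PlusMinusTower` / `Def23_i_indices` consumer should be instantiated with `emb :=` this record's
  `inclPlain` (index `l²`, not the printed `l`). Consumers citing [IUTchII] Prop. 2.1 AT THE MODEL should
  bind `BadPlaceSetting.ofUnderline`.**
* `ofDoubleUnderline_refYdd_comap` / `_refY_comap` — the reference top row `Π_v ∩ Π^tp_{Ÿ_v}`,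
  `Π_v ∩ Π^tp_{Y_v}` IS L2-t8's `Π^tp_Ÿ̲̲`, `Π^tp_Y̲̲` inside `Π^tp_X̲̲` (the `PiYdd`, `PiY` of L2-t8's
  `thetaEnvData`, and abc-iut-L6-t1's `EtaleThetaDataOfSetting.PiYdd C`).

WHAT IS PROVED.
* `ThetaEnvData.map_PiY_eq_of_map_PiYdd` (dot-notation extension of abc-iut-L2-t2's interface
  `EtaleTheta.ThetaEnvData`, [EtTh] Def. 2.13 "notation of the above discussion"): **the `Y`-clause is
  group theory** — an automorphism of `Π^tp_X̲̲` stabilising `Π^tp_Ÿ̲̲` stabilises `Π^tp_Y̲̲`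
  (`Π^tp_X̲̲/Π^tp_Y̲̲ ≅ ℤ` via `galYX` is torsion-free, `[Π^tp_Y̲̲ : Π^tp_Ÿ̲̲] = 2` via `index_PiYdd`: squares
  of `Π^tp_Y̲̲` lie in `Π^tp_Ÿ̲̲`, and an element whose square lies in `Π^tp_Y̲̲` lies in `Π^tp_Y̲̲`); hence
  `ThetaEnvData.isTopCharacteristic_PiY_of_PiYdd`.
* AT THE MODEL, from abc-iut-L6-t1's single named tempered-anabelian input
  (H1) `EtaleThetaDataOfSetting.PiYddCharacteristic C` ("every topological automorphism of `Π^tp_X̲̲`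
  stabilises `Π^tp_Ÿ̲̲`", [EtTh] Cor. 2.18 (i) form — NOT proved here): both hypotheses `hY`, `hYdd` of
  abc-iut-w4-d010's `TemperedCoverings.YL_eq_of_characteristic` (p411925) HOLD
  (`isTopCharacteristic_refY_refYdd_ofDoubleUnderline`), hence
  `TemperedCoverings.YL_eq_of_piYddCharacteristic`: **[IUTchII] Prop. 2.1 is well defined at the [EtTh]
  model** ("may be reconstructed … from `Π^tp_{X̲̲_v}`", p. 65) modulo (H1) alone.

[claim: Mochizuki2012, status: disputed] Nothing here takes a side on [IUTchIII] Cor. 3.12; typed ≠ proved.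
Deliberately NOT here: (H1) itself (tempered anabelian rigidity, [EtTh] Cor. 2.18 (i) / Prop. 2.4 — cf. the
`TemperedCoverData` route `TemperedCoveringsCharacteristic.lean`), Prop. 2.2, the mono-theta side of B8.
-/

noncomputable section

namespace Literature.IUT.HodgeArakelov

open Literature.AnabelianGeometry.EtaleTheta

/-! ## 1. The `Y`-clause over abc-iut-L2-t2's `ThetaEnvData` (group theory) -/

section YClause

universe u

variable {N : ℕ+} (T : Literature.AnabelianGeometry.EtaleTheta.ThetaEnvData.{u} N)

/-- `[Π^tp_Y : Π^tp_Ÿ] = 2`: the square of an element of `Π^tp_Y` lies in `Π^tp_Ÿ` (field `index_PiYdd`).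
Dot-notation extension of abc-iut-L2-t2's `EtaleTheta.ThetaEnvData`, declared with its absolute name.
[cite: MochizukiEtTh2009, Def 2.13 p.47] -/
theorem _root_.Literature.AnabelianGeometry.EtaleTheta.ThetaEnvData.sq_mem_PiYdd_of_mem_PiY {y : T.PiX}
    (hy : y ∈ T.PiY) : y * y ∈ T.PiYdd := by
  have h := Subgroup.mul_self_mem_of_index_two T.index_PiYdd ⟨y, hy⟩
  rw [Subgroup.mem_subgroupOf] at h
  exact h

/-- `Π^tp_X/Π^tp_Y ≅ ℤ` (field `galYX`) is torsion-free: an element whose square lies in `Π^tp_Y` lies in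
`Π^tp_Y`. [cite: MochizukiEtTh2009, Def 2.13 p.47] -/
theorem _root_.Literature.AnabelianGeometry.EtaleTheta.ThetaEnvData.mem_PiY_of_mul_self_mem {x : T.PiX}
    (h2 : x * x ∈ T.PiY) : x ∈ T.PiY := by
  haveI : T.PiY.Normal := T.PiY_normal
  have hsq : (QuotientGroup.mk (x * x) : T.PiX ⧸ T.PiY) = 1 := by
    rw [QuotientGroup.eq_one_iff]
    exact h2
  set z := T.galYX (QuotientGroup.mk x) with hzdef
  have hzz : z * z = 1 := by
    rw [hzdef, ← map_mul, ← QuotientGroup.mk_mul, hsq, map_one]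
  have hz0 : Multiplicative.toAdd z = 0 := by
    have h := congrArg Multiplicative.toAdd hzz
    rw [toAdd_mul, toAdd_one] at h
    omega
  have hz1 : z = 1 := Multiplicative.toAdd.injective (by rw [hz0, toAdd_one])
  have hmk : (QuotientGroup.mk x : T.PiX ⧸ T.PiY) = 1 := (map_eq_one_iff T.galYX T.galYX.injective).mp hz1
  rw [QuotientGroup.eq_one_iff] at hmk
  exact hmk

/-- An automorphism of `Π^tp_X` stabilising `Π^tp_Ÿ` maps `Π^tp_Y` INTO itself.
[cite: MochizukiEtTh2009, Def 2.13 p.47] -/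
theorem _root_.Literature.AnabelianGeometry.EtaleTheta.ThetaEnvData.map_PiY_le_of_map_PiYdd
    (Γ : T.PiX ≃* T.PiX) (hYdd : T.PiYdd.map Γ.toMonoidHom = T.PiYdd) :
    T.PiY.map Γ.toMonoidHom ≤ T.PiY := by
  rintro _ ⟨y, hy, rfl⟩
  refine T.mem_PiY_of_mul_self_mem ?_
  have h : Γ (y * y) ∈ T.PiYdd := by
    rw [← hYdd]
    exact ⟨y * y, T.sq_mem_PiYdd_of_mem_PiY hy, rfl⟩
  rw [map_mul] at h
  exact T.PiYdd_le h

/-- **The `Y`-clause is group theory**: an automorphism of the group `Π^tp_X` (of type `(1,(ℤ/lℤ)^Θ)`, [EtTh]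
Def. 2.13) stabilising `Π^tp_Ÿ` stabilises `Π^tp_Y`. [cite: MochizukiEtTh2009, Def 2.13 p.47] -/
theorem _root_.Literature.AnabelianGeometry.EtaleTheta.ThetaEnvData.map_PiY_eq_of_map_PiYdd
    (Γ : T.PiX ≃* T.PiX) (hYdd : T.PiYdd.map Γ.toMonoidHom = T.PiYdd) :
    T.PiY.map Γ.toMonoidHom = T.PiY := by
  refine le_antisymm (T.map_PiY_le_of_map_PiYdd Γ hYdd) fun y hy => ?_
  have hYdd' : T.PiYdd.map Γ.symm.toMonoidHom = T.PiYdd := by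
    refine le_antisymm ?_ fun x hx => ⟨Γ x, hYdd ▸ ⟨x, hx, rfl⟩, Γ.symm_apply_apply x⟩
    rintro _ ⟨k, hk, rfl⟩
    rw [← hYdd] at hk
    obtain ⟨k', hk', rfl⟩ := hk
    change Γ.symm (Γ k') ∈ T.PiYdd
    rwa [Γ.symm_apply_apply]
  have h' := T.map_PiY_le_of_map_PiYdd Γ.symm hYdd'
  exact ⟨Γ.symm y, h' ⟨y, hy, rfl⟩, Γ.apply_symm_apply y⟩

/-- If `Π^tp_Ÿ` is characteristic in the topological group `Π^tp_X` then so is `Π^tp_Y`.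
[cite: MochizukiEtTh2009, Def 2.13 p.47] -/
theorem _root_.Literature.AnabelianGeometry.EtaleTheta.ThetaEnvData.isTopCharacteristic_PiY_of_PiYdd
    (h : IsTopCharacteristic T.PiX T.PiYdd) : IsTopCharacteristic T.PiX T.PiY :=
  fun φ => T.map_PiY_eq_of_map_PiYdd φ.toMulEquiv (h φ)

end YClause

/-! ## 2. The `BadPlaceSetting` of the Tate curve -/

namespace BadPlaceSetting

variable {p : ℕ} [Fact p.Prime] {D : Literature.AnabelianGeometry.EtaleTheta.ThetaSetting p}
  {E : D.EtaleThetaData} {l : ℕ} (C : E.DoubleUnderline l) {N : ℕ+} (μ : D.CyclotomeMod l N)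
  (hC : D.Compat) (hS : D.Sec2Hyps)

/-- **[IUTchII] §2 p. 64, the fixed data at `v ∈ 𝕍^bad`, AT THE [EtTh] MODEL**: the [IUTchII] §1 setting
`ThetaSetting.ofDoubleUnderline` of the Tate curve (bridge B8: `Π_v := Π^tp_X̲̲ = C.Huu`, the [EtTh] model
mono-theta environment) extended by a bottom row for Prop. 2.1 with AMBIENT GROUP `PiXplain := Π^tp_X`
(`D.PiTemp`, the [EtTh] §1 curve `X` of type `(1,1)`), the open injection `Π^tp_X̲̲ ↪ Π^tp_X`, and reference
subgroups `Π^tp_Y = Ker(Π^tp_X ↠ Z)`, `Π^tp_Ÿ` (open since `K = K̈`). MODEL-IDENTIFICATION NOTE (finding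
F-L6t19g5-1; doc-only disclosure, statement unchanged): print's "`Π^tp_{X_v}`" at `v ∈ 𝕍^bad` is
`Π^tp_{X̲_v}` (`X̲_v` of type `(1, l-tors)`, [IUTchI] Def. 3.1 (d)(e), [IUTchII] Def. 2.3 (i) index `l`) =
abc-iut-L2-t7's `D.GtpXu l`, so this record is the `(1,1)`-AMBIENT VARIANT (`[Π^tp_X : Π_v] = l²`); the
PRINT-LEVEL model is `BadPlaceSetting.ofUnderline` (BadPlaceSettingOfUnderline.lean), which has the same
`toThetaSetting` and the same pair of reference subgroups of `Π_v` (its `_refY_comap` / `_refYdd_comap` are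
`rfl` against this file's), so the theorems below transfer verbatim. A CONSTRUCTION over landed data; the
printed extra hypotheses of [IUTchII] §1 p. 20 ("`l` an odd prime", "`p` odd, `p ≠ l`", "`k ∋` a primitive
`4l`-th root of unity") and the chosen theta cocycle `η` are the arguments of B8.
[claim: Mochizuki2012, status: disputed] -/
def ofDoubleUnderline (hl : l.Prime) (hp2 : p ≠ 2) (hpl : p ≠ l)
    (hζ : ∃ ζ : D.K, IsPrimitiveRoot ζ (4 * l)) {η : (C.thetaEnvData μ hC hS).PiYdd → MuN p N}
    (hη : η ∈ (C.thetaEnvData μ hC hS).thetaCocycles) : BadPlaceSetting.{0} where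
  toThetaSetting := ThetaSetting.ofDoubleUnderline C μ hC hS hl hp2 hpl hζ hη
  PiXplain := TopGroup.of D.PiTemp
  inclPlain := C.Huu.subtype
  inclPlain_isOpenEmbedding := C.isOpen_Huu.isOpenEmbedding_subtypeVal
  refY := D.GtpY
  refYdd := D.GtpYdd
  refYdd_le := D.GtpYdd_le_GtpY
  isOpen_refY := D.isOpen_ker_toZ
  isOpen_refYdd :=
    Literature.AnabelianGeometry.EtaleTheta.ThetaSetting.EtaleThetaData.DoubleUnderline.isOpen_GtpYdd hS

variable (hl : l.Prime) (hp2 : p ≠ 2) (hpl : p ≠ l) (hζ : ∃ ζ : D.K, IsPrimitiveRoot ζ (4 * l))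
  {η : (C.thetaEnvData μ hC hS).PiYdd → MuN p N} (hη : η ∈ (C.thetaEnvData μ hC hS).thetaCocycles)

/-- Bookkeeping: `Π_v` of the model bad-place setting is `Π^tp_X̲̲ = C.Huu`, its level is `N`, its ambient
`PiXplain` is `Π^tp_X` (the `(1,1)` curve's group — print's `Π^tp_{X_v} = Π^tp_{X̲_v}` is `D.GtpXu l`, cf.
`BadPlaceSetting.ofUnderline_PiX`; finding F-L6t19g5-1). [claim: Mochizuki2012, status: disputed] -/
theorem ofDoubleUnderline_PiX :
    ((ofDoubleUnderline C μ hC hS hl hp2 hpl hζ hη).PiX : Type) = C.Huu ∧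
      (ofDoubleUnderline C μ hC hS hl hp2 hpl hζ hη).N = N ∧
      ((ofDoubleUnderline C μ hC hS hl hp2 hpl hζ hη).PiXplain : Type) = D.PiTemp :=
  ⟨rfl, rfl, rfl⟩

/-- The reference subgroup `Π_v ∩ Π^tp_{Ÿ_v}` of the model IS `Π^tp_Ÿ̲̲ ⊆ Π^tp_X̲̲` — L2-t8's
`(C.thetaEnvData …).PiYdd = D.GtpYdd.subgroupOf C.Huu`, equal to abc-iut-L6-t1's
`EtaleThetaDataOfSetting.PiYdd C`. [claim: Mochizuki2012, status: disputed] -/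
theorem ofDoubleUnderline_refYdd_comap :
    (ofDoubleUnderline C μ hC hS hl hp2 hpl hζ hη).refYdd.comap
        (ofDoubleUnderline C μ hC hS hl hp2 hpl hζ hη).inclPlain = D.GtpYdd.subgroupOf C.Huu ∧
      EtaleThetaDataOfSetting.PiYdd C = D.GtpYdd.subgroupOf C.Huu :=
  ⟨rfl, Subgroup.inf_subgroupOf_right D.GtpYdd C.Huu⟩

/-- The reference subgroup `Π_v ∩ Π^tp_{Y_v}` of the model IS `Π^tp_Y̲̲ = Π^tp_Y ∩ Π^tp_X̲̲ ⊆ Π^tp_X̲̲` —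
L2-t8's `(C.thetaEnvData …).PiY = D.GtpY.subgroupOf C.Huu`. [claim: Mochizuki2012, status: disputed] -/
theorem ofDoubleUnderline_refY_comap :
    (ofDoubleUnderline C μ hC hS hl hp2 hpl hζ hη).refY.comap
        (ofDoubleUnderline C μ hC hS hl hp2 hpl hζ hη).inclPlain = (C.thetaEnvData μ hC hS).PiY :=
  rfl

/-! ## 3. Prop. 2.1's anabelian input at the model = (H1) -/

/-- AT THE MODEL, abc-iut-L6-t1's named tempered-anabelian input (H1) `PiYddCharacteristic C` ("every
topological automorphism of `Π^tp_X̲̲` stabilises `Π^tp_Ÿ̲̲`") gives BOTH hypotheses of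
`TemperedCoverings.YL_eq_of_characteristic`: `Π_v ∩ Π^tp_{Ÿ_v}` is characteristic in `Π_v` (this IS (H1))
and `Π_v ∩ Π^tp_{Y_v}` is characteristic in `Π_v` (the `Y`-clause, `ThetaEnvData.isTopCharacteristic_PiY_of_PiYdd`).
[claim: Mochizuki2012, status: disputed] -/
theorem isTopCharacteristic_refY_refYdd_ofDoubleUnderline (hH1 : EtaleThetaDataOfSetting.PiYddCharacteristic C) :
    IsTopCharacteristic (ofDoubleUnderline C μ hC hS hl hp2 hpl hζ hη).PiX
        ((ofDoubleUnderline C μ hC hS hl hp2 hpl hζ hη).refY.comap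
          (ofDoubleUnderline C μ hC hS hl hp2 hpl hζ hη).inclPlain) ∧
      IsTopCharacteristic (ofDoubleUnderline C μ hC hS hl hp2 hpl hζ hη).PiX
        ((ofDoubleUnderline C μ hC hS hl hp2 hpl hζ hη).refYdd.comap
          (ofDoubleUnderline C μ hC hS hl hp2 hpl hζ hη).inclPlain) := by
  have hYdd : IsTopCharacteristic (C.thetaEnvData μ hC hS).PiX (C.thetaEnvData μ hC hS).PiYdd := by
    intro φ
    have h := hH1 φ
    rw [(ofDoubleUnderline_refYdd_comap C μ hC hS hl hp2 hpl hζ hη).2] at h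
    exact h
  exact ⟨(C.thetaEnvData μ hC hS).isTopCharacteristic_PiY_of_PiYdd hYdd, hYdd⟩

/-- **[IUTchII] Prop. 2.1, well-definedness AT THE [EtTh] MODEL modulo (H1)** (composition with
abc-iut-w4-d010's `TemperedCoverings.YL_eq_of_characteristic`, p411925): if every topological automorphism of
`Π^tp_X̲̲` stabilises `Π^tp_Ÿ̲̲`, then any two Prop. 2.1 outputs over the same topological group `P` for the
model bad-place setting have the same top row `Π^tp_{Ÿ̲_v} ⊆ Π^tp_{Y̲_v} ⊆ P` ("may be reconstructed … from
`Π^tp_{X̲̲_v}`", kurims p. 65). [claim: Mochizuki2012, status: disputed] -/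
theorem _root_.Literature.IUT.HodgeArakelov.TemperedCoverings.YL_eq_of_piYddCharacteristic
    (hH1 : EtaleThetaDataOfSetting.PiYddCharacteristic C) {P : TopGroup.{0}}
    (T₁ T₂ : TemperedCoverings (ofDoubleUnderline C μ hC hS hl hp2 hpl hζ hη) P) :
    T₁.YL = T₂.YL ∧ T₁.YddL = T₂.YddL :=
  have h := isTopCharacteristic_refY_refYdd_ofDoubleUnderline C μ hC hS hl hp2 hpl hζ hη hH1
  TemperedCoverings.YL_eq_of_characteristic h.1 h.2 T₁ T₂

end BadPlaceSetting

end Literature.IUT.HodgeArakelov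

end
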